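import Mathlib
import HarnessLib
import Summits.RiemannHypothesis.RiemannHypothesis.Theses.MayerPairing

/-!
# RiemannHypothesis / MayerPairing — normalising the inlined eigenvalue predicate

Route `RiemannHypothesis/MayerPairing`, item stmt-RiemannHypothesis-1473 (`Target`), helper file.

Every item of the route types "μ is an eigenvalue of Mayer's transfer operator `L_s`" as
`∃ f δ, 0 < δ ∧ f holomorphic on {Re z > -δ} ∧ (∃ z, Re z > 0 ∧ f z ≠ 0) ∧
   (∀ z, Re z > -δ → μ (f z - f (z+1)) = (z+1)^{-2s} f (1/(z+1))) ∧
   μ f x - f 0 (x+1)^{1-2s}/(2s-1) → 0 (x → +∞)`.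
Two normalisations, valid for every `s μ : ℂ`:

* `mayerPairing_eigenvalue_ne_zero` : the predicate forces `μ ≠ 0` (if `μ = 0` the equation
  kills `f` on the disc `{1/(z+1) : Re z > 0} = B(1/2, 1/2)`, hence on the right half-plane by the
  identity theorem, contradicting `f ≢ 0` there);
* `mayerPairing_eigenvalue_delta_one` : the half-plane can always be taken to be `{Re z > -1}`
  (`δ = 1`): `g z := f (z+1) + μ⁻¹ (z+1)^{-2s} f (1/(z+1))` is holomorphic on `{Re z > -1}`, agrees
  with `f` wherever the functional equation holds, and inherits equation and asymptotics. In
  particular every witness lives on a neighbourhood of the closure of Mayer's disc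
  `D = {|z - 1| < 3/2} ⊂ {Re z > -1/2}`, i.e. restricts to an element of the Banach space `B(D)`.

Consequence recorded for the target: `mayerPairing_unitCircleCrossedOnce_iff_delta_one` and
`mayerPairing_target_iff_delta_one` — in `UnitCircleCrossedOnce` (hence in `Target`) the
eigenvalue hypothesis on the selection `Λ` may be taken with `δ = 1`, which is the form a proof
of the crux would start from.

Mathlib only. References: D. Mayer, Bull. AMS 25 (1991) 55–60; C.-H. Chang and D. Mayer,
Contemp. Math. 290 (2001), (2.47)–(2.49) and Prop. 4.1.
-/

namespace Summit.RiemannHypothesis.RiemannHypothesis.Theorems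

open Filter Topology
open Summit.RiemannHypothesis.RiemannHypothesis.Theses.MayerPairing

/-- **The inlined Mayer-eigenvalue predicate excludes `μ = 0`.** With `μ = 0` the functional
equation gives `f (1/(z+1)) = 0` for `Re z > 0`, i.e. `f = 0` on the disc `B(1/2, 1/2)`; by the
identity theorem `f = 0` on the (connected) right half-plane, contradicting the non-vanishing
clause. [folklore] -/
theorem mayerPairing_eigenvalue_ne_zero (s μ : ℂ)
    (h : ∃ f : ℂ → ℂ, ∃ δ : ℝ, 0 < δ ∧ DifferentiableOn ℂ f {z : ℂ | -δ < z.re} ∧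
      (∃ z : ℂ, 0 < z.re ∧ f z ≠ 0) ∧
      (∀ z : ℂ, -δ < z.re → μ * (f z - f (z + 1)) = (z + 1) ^ (-(2 * s)) * f (1 / (z + 1))) ∧
      Tendsto (fun x : ℝ => μ * f x - f 0 * ((x : ℂ) + 1) ^ (1 - 2 * s) / (2 * s - 1))
        atTop (𝓝 0)) :
    μ ≠ 0 := by
  rintro rfl
  obtain ⟨f, δ, hδ, hdiff, ⟨z₀, hz₀, hfz₀⟩, hfe, -⟩ := h
  -- `f` vanishes on the disc `B(1/2, 1/2)`, the image of `{Re z > 0}` under `z ↦ 1/(z+1)`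
  have hvan : ∀ w : ℂ, w ∈ Metric.ball (1 / 2 : ℂ) (1 / 2) → f w = 0 := by
    intro w hw
    rw [Metric.mem_ball, dist_eq_norm] at hw
    have hsq : Complex.normSq (w - 1 / 2) < 1 / 4 := by
      rw [Complex.normSq_eq_norm_sq]
      nlinarith [norm_nonneg (w - 1 / 2)]
    have hre : Complex.normSq w < w.re := by
      rw [Complex.normSq_apply] at hsq ⊢
      simp only [Complex.sub_re, Complex.sub_im, Complex.div_ofNat_re, Complex.one_re,
        Complex.div_ofNat_im, Complex.one_im, zero_div, sub_zero] at hsq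
      nlinarith [hsq]
    have hw0 : w ≠ 0 := by
      rintro rfl
      simp at hre
    set z : ℂ := 1 / w - 1 with hz
    have hzre : 0 < z.re := by
      rw [hz, Complex.sub_re, Complex.one_re, one_div, Complex.inv_re, lt_sub_iff_add_lt,
        zero_add, lt_div_iff₀ (Complex.normSq_pos.mpr hw0), one_mul]
      exact hre
    have key := hfe z (by linarith)
    have hz1 : z + 1 = 1 / w := by rw [hz]; ring
    rw [zero_mul, eq_comm, mul_eq_zero, hz1, one_div_one_div] at key
    rcases key with h1 | h1
    · exfalso
      rw [Complex.cpow_eq_zero_iff] at h1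
      exact (one_div_ne_zero hw0) h1.1
    · exact h1
  -- identity theorem on the right half-plane
  have hopen : IsOpen {z : ℂ | -δ < z.re} := isOpen_lt continuous_const Complex.continuous_re
  have han : AnalyticOnNhd ℂ f {z : ℂ | 0 < z.re} :=
    (hdiff.analyticOnNhd hopen).mono fun z hz => by
      simp only [Set.mem_setOf_eq] at hz ⊢
      linarith
  have hpre : IsPreconnected {z : ℂ | 0 < z.re} := (convex_halfSpace_re_gt 0).isPreconnected
  have hhalf : (1 / 2 : ℂ) ∈ {z : ℂ | 0 < z.re} := by
    simp only [Set.mem_setOf_eq, Complex.div_ofNat_re, Complex.one_re]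
    norm_num
  have hev : f =ᶠ[𝓝 (1 / 2 : ℂ)] 0 := by
    filter_upwards [Metric.ball_mem_nhds (1 / 2 : ℂ) (by norm_num : (0 : ℝ) < 1 / 2)] with w hw
    exact hvan w hw
  exact hfz₀ (han.eqOn_zero_of_preconnected_of_eventuallyEq_zero hpre hhalf hev hz₀)

/-- **`δ = 1` without loss of generality.** A witness `f` of the inlined Mayer-eigenvalue
predicate on some half-plane `{Re z > -δ}` yields the witness
`g z = f (z+1) + μ⁻¹ (z+1)^{-2s} f (1/(z+1))` on `{Re z > -1}`: `g` is holomorphic there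
(`Re (z+1) > 0`, `Re (1/(z+1)) > 0`), coincides with `f` wherever the functional equation holds,
and therefore satisfies the same equation and the same asymptotic normalisation. [folklore] -/
theorem mayerPairing_eigenvalue_delta_one (s μ : ℂ)
    (h : ∃ f : ℂ → ℂ, ∃ δ : ℝ, 0 < δ ∧ DifferentiableOn ℂ f {z : ℂ | -δ < z.re} ∧
      (∃ z : ℂ, 0 < z.re ∧ f z ≠ 0) ∧
      (∀ z : ℂ, -δ < z.re → μ * (f z - f (z + 1)) = (z + 1) ^ (-(2 * s)) * f (1 / (z + 1))) ∧
      Tendsto (fun x : ℝ => μ * f x - f 0 * ((x : ℂ) + 1) ^ (1 - 2 * s) / (2 * s - 1))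
        atTop (𝓝 0)) :
    ∃ f : ℂ → ℂ, DifferentiableOn ℂ f {z : ℂ | -1 < z.re} ∧
      (∃ z : ℂ, 0 < z.re ∧ f z ≠ 0) ∧
      (∀ z : ℂ, -1 < z.re → μ * (f z - f (z + 1)) = (z + 1) ^ (-(2 * s)) * f (1 / (z + 1))) ∧
      Tendsto (fun x : ℝ => μ * f x - f 0 * ((x : ℂ) + 1) ^ (1 - 2 * s) / (2 * s - 1))
        atTop (𝓝 0) := by
  have hμ := mayerPairing_eigenvalue_ne_zero s μ h
  obtain ⟨f, δ, hδ, hdiff, ⟨z₀, hz₀, hfz₀⟩, hfe, hlim⟩ := h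
  set g : ℂ → ℂ := fun z => f (z + 1) + μ⁻¹ * ((z + 1) ^ (-(2 * s)) * f (1 / (z + 1))) with hg
  -- `g = f` wherever the functional equation holds
  have hagree : ∀ z : ℂ, -δ < z.re → g z = f z := by
    intro z hz
    have := hfe z hz
    simp only [hg]
    rw [← this]
    field_simp
    ring
  -- real parts of `z + 1` and `1/(z+1)` on `{Re z > -1}`
  have hre1 : ∀ z : ℂ, -1 < z.re → 0 < (z + 1).re := by
    intro z hz
    rw [Complex.add_re, Complex.one_re]
    linarith
  have hne1 : ∀ z : ℂ, -1 < z.re → z + 1 ≠ 0 := by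
    intro z hz h0
    have := hre1 z hz
    rw [h0, Complex.zero_re] at this
    exact lt_irrefl _ this
  have hre2 : ∀ z : ℂ, -1 < z.re → 0 < (1 / (z + 1)).re := by
    intro z hz
    rw [one_div, Complex.inv_re]
    exact div_pos (hre1 z hz) (Complex.normSq_pos.mpr (hne1 z hz))
  have hopen : IsOpen {z : ℂ | -δ < z.re} := isOpen_lt continuous_const Complex.continuous_re
  refine ⟨g, ?_, ⟨z₀, hz₀, by rw [hagree z₀ (by linarith)]; exact hfz₀⟩, ?_, ?_⟩
  · -- holomorphy on `{Re z > -1}`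
    intro z hz
    simp only [Set.mem_setOf_eq] at hz
    have hf1 : DifferentiableAt ℂ f (z + 1) :=
      hdiff.differentiableAt (hopen.mem_nhds (by
        simp only [Set.mem_setOf_eq]
        linarith [hre1 z hz]))
    have hf2 : DifferentiableAt ℂ f (1 / (z + 1)) :=
      hdiff.differentiableAt (hopen.mem_nhds (by
        simp only [Set.mem_setOf_eq]
        linarith [hre2 z hz]))
    have hid : DifferentiableAt ℂ (fun w : ℂ => w + 1) z := differentiableAt_id.add_const 1
    have hA : DifferentiableAt ℂ (fun w : ℂ => f (w + 1)) z := hf1.comp z hid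
    have hB : DifferentiableAt ℂ (fun w : ℂ => (w + 1) ^ (-(2 * s))) z :=
      hid.cpow_const (Or.inl (hre1 z hz))
    have hinv : DifferentiableAt ℂ (fun w : ℂ => 1 / (w + 1)) z :=
      (differentiableAt_const (1 : ℂ)).div hid (hne1 z hz)
    have hC : DifferentiableAt ℂ (fun w : ℂ => f (1 / (w + 1))) z := hf2.comp z hinv
    have hg' : DifferentiableAt ℂ g z := by
      simp only [hg]
      exact hA.add ((hB.mul hC).const_mul μ⁻¹)
    exact hg'.differentiableWithinAt
  · -- the functional equation on `{Re z > -1}`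
    intro z hz
    rw [hagree (z + 1) (by linarith [hre1 z hz]), hagree (1 / (z + 1)) (by linarith [hre2 z hz])]
    simp only [hg]
    field_simp
    ring
  · -- asymptotic normalisation: `g 0 = f 0` and `g x = f x` for `x > 0`
    have h0 : g 0 = f 0 := hagree 0 (by rw [Complex.zero_re]; linarith)
    refine hlim.congr' ?_
    filter_upwards [eventually_gt_atTop (0 : ℝ)] with x hx
    rw [h0, hagree x (by rw [Complex.ofReal_re]; linarith)]

/-- **`δ = 1` in the monotonicity crux.** `UnitCircleCrossedOnce` is equivalent to the version in
which the eigenvalue hypothesis on the selection `Λ` is stated with witnesses holomorphic on the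
fixed half-plane `{Re z > -1}` (by `mayerPairing_eigenvalue_delta_one`); this is the form a proof of
the crux starts from (witnesses restrict to Mayer's Banach space `B(D)`, `D = {|z-1| < 3/2}`).
[folklore] -/
theorem mayerPairing_unitCircleCrossedOnce_iff_delta_one :
    UnitCircleCrossedOnce ↔
    (∀ τ : ℝ, 7 ≤ |τ| → ∀ a b : ℝ, 0 < a → a < b → b < 1 / 2 → ∀ Λ : ℝ → ℂ,
      ContinuousOn Λ (Set.Icc a b) →
      (∀ σ ∈ Set.Icc a b, ∃ f : ℂ → ℂ, DifferentiableOn ℂ f {z : ℂ | -1 < z.re} ∧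
        (∃ z : ℂ, 0 < z.re ∧ f z ≠ 0) ∧
        (∀ z : ℂ, -1 < z.re → Λ σ * (f z - f (z + 1)) =
          (z + 1) ^ (-(2 * ((σ : ℂ) + (τ : ℂ) * Complex.I))) * f (1 / (z + 1))) ∧
        Tendsto (fun x : ℝ => Λ σ * f x -
          f 0 * ((x : ℂ) + 1) ^ (1 - 2 * ((σ : ℂ) + (τ : ℂ) * Complex.I)) /
          (2 * ((σ : ℂ) + (τ : ℂ) * Complex.I) - 1)) atTop (𝓝 0)) →
      ¬ (‖Λ a‖ = 1 ∧ ‖Λ b‖ = 1)) := by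
  constructor
  · intro h τ hτ a b ha hab hb Λ hΛ heig
    refine h τ hτ a b ha hab hb Λ hΛ fun σ hσ => ?_
    obtain ⟨f, hdiff, hnz, hfe, hlim⟩ := heig σ hσ
    exact ⟨f, 1, one_pos, hdiff, hnz, hfe, hlim⟩
  · intro h τ hτ a b ha hab hb Λ hΛ heig
    exact h τ hτ a b ha hab hb Λ hΛ fun σ hσ =>
      mayerPairing_eigenvalue_delta_one ((σ : ℂ) + (τ : ℂ) * Complex.I) (Λ σ) (heig σ hσ)

/-- **`δ = 1` in the target**: `Target ↔ UnitCircleCrossedOnce₁ ∧ BranchPairing`, where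
`UnitCircleCrossedOnce₁` is the monotonicity crux with eigenvalue witnesses on `{Re z > -1}`
(`mayerPairing_unitCircleCrossedOnce_iff_delta_one`). [folklore] -/
theorem mayerPairing_target_iff_delta_one :
    Target ↔
    ((∀ τ : ℝ, 7 ≤ |τ| → ∀ a b : ℝ, 0 < a → a < b → b < 1 / 2 → ∀ Λ : ℝ → ℂ,
      ContinuousOn Λ (Set.Icc a b) →
      (∀ σ ∈ Set.Icc a b, ∃ f : ℂ → ℂ, DifferentiableOn ℂ f {z : ℂ | -1 < z.re} ∧
        (∃ z : ℂ, 0 < z.re ∧ f z ≠ 0) ∧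
        (∀ z : ℂ, -1 < z.re → Λ σ * (f z - f (z + 1)) =
          (z + 1) ^ (-(2 * ((σ : ℂ) + (τ : ℂ) * Complex.I))) * f (1 / (z + 1))) ∧
        Tendsto (fun x : ℝ => Λ σ * f x -
          f 0 * ((x : ℂ) + 1) ^ (1 - 2 * ((σ : ℂ) + (τ : ℂ) * Complex.I)) /
          (2 * ((σ : ℂ) + (τ : ℂ) * Complex.I) - 1)) atTop (𝓝 0)) →
      ¬ (‖Λ a‖ = 1 ∧ ‖Λ b‖ = 1)) ∧ BranchPairing) := by
  change (UnitCircleCrossedOnce ∧ BranchPairing) ↔ _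
  rw [mayerPairing_unitCircleCrossedOnce_iff_delta_one]

end Summit.RiemannHypothesis.RiemannHypothesis.Theorems
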